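import Summits.QuantumFields.YangMills.Theorems.UnitScaleTiltProp8FlatProp4Background1
import HarnessLib

/-!
# Route `UnitScaleTilt`, crux K1 child «MinimiserStabilityRegPr» (stmt-QuantumFields-19200), registered stub V2′ `stub_halvingStep` (v8 5b4e846794b80374 ∕ v10
# `BirthV10`) — pillars P3b∕P5 at background 1: **THE WILSON ACTION IN THE FLAT EXPONENTIAL CHART — VALUE AND GRADIENT.**  For `η > 0` and a `M₂(ℂ)`-valued bond
# field `A`, the holomorphic plaquette action `𝒮_η(A) := Σ_p [1 − ½tr(e^{iηA(b₁)}e^{iηA(b₂)}e^{−iηA(b₃)}e^{−iηA(b₄)})]` splits EXACTLY as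
# `𝒮_η(A) = (η²/4)·Σ_p tr(Φ_p(A)²) + 𝒱_η(A)`, `Φ_p(A) = A(b₁) + A(b₂) − A(b₃) − A(b₄)` (the linear term `−(iη/2)Σ_p tr Φ_p(A)` vanishes identically,
# `FlatPlaqIncidence.sum_plaq_curl_eq_zero`; `𝒱_η` = P3b's non-quadratic part), its derivative is
# `D𝒮_η(A)[δ] = (η²/2)·Σ_p tr(Φ_p(A)Φ_p(δ)) + η⁴·Σ_b tr(W₀(A)(b)δ(b))` with P3b's gradient `W₀` (✓ `FlatProp4Bg1.exists_gradient_prop4_bg1`, p596336), and for a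
# HERMITIAN field `A` and any `SU(2)` configuration `U` with `U(b) = e^{iηA(b)}` the tree's Wilson action is its real part: `wilsonAction4 U = Re 𝒮_η(A)`

Cell `ym3-torus` (HUMAN RULING D-0037, YM ladder rung R3 — continuum SU(2) YM₃ on the torus is a RUNG, not the Clay problem), width seat `ym-ust-19200-w5` gen 2
(P3b lineage; `P3B-W5-MEMO.md` §4 «the 20-line corollary left to P5»).  `--supports stmt-QuantumFields-19200 --as helper`; def-free, 0 sorry, standard axioms.
WHY: Sect. F's functional (157) `𝔊(A′) = ½⟨A′ − HD(A′), ∂*∂(A′ − HD(A′))⟩ + V₀(A′ − HD(A′))` IS `𝒮_η ∘ (1 − HD)` (print's `η^{4−d}` normalisation: `½⟨A, ∂*∂A⟩ =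
(η²/4)Σ_p tr Φ_p(A)²` in the pairing `η^dΣ tr` at `d = 3`… up to print's constants), so this file is the «`g = Δx + w`» input of the E–L junction at background 1
(w3's `FlatCriticalOfMin.hcrit_of_isMinOn_affineBall` ∕ F4 `FlatCriticalEquation143.eq143_of_critical`: the gradient of the minimised functional = flat `∂*∂`-pairing +
`W`) and the identification of the functional the minimiser `U` of the route minimises (`wilsonAction4`) with the charted one.

THE PRINT ([Balaban1985Variational] = T. Bałaban, CMP **102** (1985) 277–309; journal page = PDF page + 276).  p. 278 (5): *«A(U) = Σ_p η^{d−4}[1 − Re tr U(∂p)]»*;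
p. 282 (26)–(27) (the expansion of the action at a background, linear + quadratic + `V₀`); p. 302 (157)–(158): *«𝔊(A′) = ½⟨A′ − HD(A′), ∂^{η*}∂^η(A′ − HD(A′))⟩ +
V₀(A′ − HD(A′)) … all the operators in this section are taken without any external gauge field configuration (or alternatively with the configuration equal to 1)»*;
p. 293 (99): *«⟨δA′, J⟩ + ⟨δA′, Δ₁A′⟩ + ⟨δA′, (δ/δA′)V(A′)⟩ = 0»*.

WHAT THIS FILE PROVES (every `Params` `P`, level `j`, `η : ℝ`; `c := iη`; the four slots `Y₁ = cA(b₁)`, `Y₂ = cA(b₂)`, `Y₃ = −cA(b₃)`, `Y₄ = −cA(b₄)` of the plaquette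
`p = (x; μ < ν)`, `b₁ = ⟨x, μ⟩`, `b₂ = ⟨x + e_μ, ν⟩`, `b₃ = ⟨x + e_ν, μ⟩`, `b₄ = ⟨x, ν⟩` — the order of the tree's `GaugeField.plaqHol`):
* §1 `slots_sum_eq_smul_curl` (`ΣYᵢ = c·Φ_p(A)`), `plaq_term_eq` (`1 − ½trΠ = 𝔣 − ½tr ΣY − ¼tr(ΣY)²`, 𝔣 = P3b's summand), `trace_smul_curl_sq`.
* §2 **`action_eq_quad_add_V`** — `𝒮_η(A) = (η²/4)·Σ_p tr(Φ_p(A)²) + 𝒱_η(A)` for EVERY field `A` (no smallness).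
* §3 `hasDerivAt_trace_sq_line`, `differentiable_quad`, **`fderiv_quad`** — the quadratic form `𝒬(A) = Σ_p tr(Φ_p(A)²)` is differentiable with
  `D𝒬(A)[δ] = 2Σ_p tr(Φ_p(A)Φ_p(δ))`.
* §4 **`exists_gradient_action`** — for `0 < η ≤ 1`: P3b's `W₀` (its four properties VERBATIM from `exists_gradient_prop4_bg1`) together with: `𝒮_η` differentiable and
  `D𝒮_η(A)[δ] = (η²/2)·Σ_p tr(Φ_p(A)Φ_p(δ)) + η⁴·Σ_b tr(W₀(A)(b)δ(b))` for all `A, δ`; **`exists_gradient_action_T3`** — the same at the d = 3 carrier (`P = F.P K`,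
  `η = L^{−(K−n)}`, letters of `exists_gradient_prop4_bg1_T3`: weight `L^{K−n}`, `C₄ = 18000`, `a₃ = ½`).
* §5 `coe_inv_eq_exp_neg`, **`wilsonAction4_eq_re_action`** — for `A` bondwise self-adjoint and `U : GaugeField P j SU(2)` with `↑(U b) = e^{iηA(b)}` for all `b`:
  `wilsonAction4 U = Re 𝒮_η(A)` (`reTr = ½Re tr` on `SU(2)`; `↑(U⁻¹) = (e^{iηA})* = e^{−iηA}` by `star_exp` and `A* = A`).
HONEST SCOPE: exact algebra and first-order calculus on top of P3b; the pairing∕coordinates dictionary `M₂(ℂ)`-valued fields ↔ F4's real index `ι → ℝ` (in which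
`(η²/2)Σ_p tr(Φ_p(A)Φ_p(δ))` becomes `⟨δ, Δx⟩` with the flat `∂^{η*}∂^η`) and the chart dressing `A′ ↦ A′ − HD(A′)` (`FlatProp4Dressing`) are NOT done here.  NOT a claim
about the stub, the crux, the rung or the mass gap.

References: T. Bałaban, CMP **102** (1985) 277–309 [Balaban1985Variational] (5) p.278, (26)–(27) p.282, (99) p.293, (157)–(158) p.302.
-/

set_option autoImplicit false

noncomputable section

open scoped BigOperators Matrix.Norms.L2Operator
open NormedSpace Finset

namespace Summit.QuantumFields.YangMills.Theorems.FlatActionGradient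

open Literature.MathematicalPhysics.QuantumFieldTheory.Balaban1983to89
open Summit.QuantumFields.YangMills.Theorems.FlatPlaqIncidence (sum_plaq_curl_eq_zero)
open Summit.QuantumFields.YangMills.Theorems.FlatProp4Bg1 (exists_gradient_prop4_bg1 exists_gradient_prop4_bg1_T3 differentiable_V)

variable {P : Params} {j : ℕ}

/-! ## §1 Per-plaquette algebra -/

section Algebra

variable (η : ℝ)

/-- `Y₁ + Y₂ + Y₃ + Y₄ = iη·Φ_p(A)`. [cite: Balaban1985Variational, (26) p.282] -/
theorem slots_sum_eq_smul_curl (A : PBond P j → Matrix (Fin 2) (Fin 2) ℂ) (p : Plaq P j) :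
    (((Complex.I * (η : ℂ)) • A ⟨p.src, p.μ⟩) + ((Complex.I * (η : ℂ)) • A ⟨p.src.shift p.μ, p.ν⟩) + (-((Complex.I * (η : ℂ)) • A ⟨p.src.shift p.ν, p.μ⟩)) + (-((Complex.I * (η : ℂ)) • A ⟨p.src, p.ν⟩))) = (Complex.I * (η : ℂ)) • (A ⟨p.src, p.μ⟩ + A ⟨p.src.shift p.μ, p.ν⟩ - A ⟨p.src.shift p.ν, p.μ⟩ - A ⟨p.src, p.ν⟩) := by
  simp only [smul_add, smul_sub]
  abel

/-- `1 − ½trΠ = 𝔣(Y) − ½tr(ΣY) − ¼tr((ΣY)²)`, `𝔣` = P3b's non-quadratic summand. [cite: Balaban1985Variational, (26)-(27) p.282] -/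
theorem plaq_term_eq (A : PBond P j → Matrix (Fin 2) (Fin 2) ℂ) (p : Plaq P j) :
    (1 - (2 : ℂ)⁻¹ * Matrix.trace (exp ((Complex.I * (η : ℂ)) • A ⟨p.src, p.μ⟩) * exp ((Complex.I * (η : ℂ)) • A ⟨p.src.shift p.μ, p.ν⟩) * exp (-((Complex.I * (η : ℂ)) • A ⟨p.src.shift p.ν, p.μ⟩)) * exp (-((Complex.I * (η : ℂ)) • A ⟨p.src, p.ν⟩)))) = (1 - (2 : ℂ)⁻¹ * Matrix.trace (exp ((Complex.I * (η : ℂ)) • A ⟨p.src, p.μ⟩) * exp ((Complex.I * (η : ℂ)) • A ⟨p.src.shift p.μ, p.ν⟩) * exp (-((Complex.I * (η : ℂ)) • A ⟨p.src.shift p.ν, p.μ⟩)) * exp (-((Complex.I * (η : ℂ)) • A ⟨p.src, p.ν⟩))) + (2 : ℂ)⁻¹ * Matrix.trace (((Complex.I * (η : ℂ)) • A ⟨p.src, p.μ⟩) + ((Complex.I * (η : ℂ)) • A ⟨p.src.shift p.μ, p.ν⟩) + (-((Complex.I * (η : ℂ)) • A ⟨p.src.shift p.ν, p.μ⟩)) +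 (-((Complex.I * (η : ℂ)) • A ⟨p.src, p.ν⟩))) + (4 : ℂ)⁻¹ * Matrix.trace ((((Complex.I * (η : ℂ)) • A ⟨p.src, p.μ⟩) + ((Complex.I * (η : ℂ)) • A ⟨p.src.shift p.μ, p.ν⟩) + (-((Complex.I * (η : ℂ)) • A ⟨p.src.shift p.ν, p.μ⟩)) + (-((Complex.I * (η : ℂ)) • A ⟨p.src, p.ν⟩))) ^ 2)) - (2 : ℂ)⁻¹ * Matrix.trace (((Complex.I * (η : ℂ)) • A ⟨p.src, p.μ⟩) + ((Complex.I * (η : ℂ)) • A ⟨p.src.shift p.μ, p.ν⟩) + (-((Complex.I * (η : ℂ)) • A ⟨p.src.shift p.ν, p.μ⟩)) + (-((Complex.I * (η : ℂ)) • A ⟨p.src, p.ν⟩))) - (4 : ℂ)⁻¹ * Matrix.trace ((((Complex.I * (η : ℂ)) • A ⟨p.src, p.μ⟩) + ((Complex.I * (η : ℂ)) • A ⟨p.src.shift p.μ, p.ν⟩) + (-((Complex.I * (η : ℂ)) • A ⟨p.src.shift p.ν, p.μ⟩)) + (-((Complex.I * (η : ℂ)) • A ⟨p.src, p.ν⟩)))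 ^ 2) := by
  ring

/-- `tr((iη·Φ)²) = −η²·tr(Φ²)`. [folklore] -/
theorem trace_smul_curl_sq (Φ : Matrix (Fin 2) (Fin 2) ℂ) :
    Matrix.trace (((Complex.I * (η : ℂ)) • Φ) ^ 2) = -((η : ℂ) ^ 2) * Matrix.trace (Φ ^ 2) := by
  rw [smul_pow, Matrix.trace_smul, smul_eq_mul, mul_pow, Complex.I_sq]
  ring

end Algebra

/-! ## §2 The action splits: `𝒮_η = (η²/4)·𝒬 + 𝒱_η` -/

section Split

variable (η : ℝ)

/-- **`𝒮_η(A) = (η²/4)·Σ_p tr(Φ_p(A)²) + 𝒱_η(A)` FOR EVERY FIELD `A`** — the linear term `−(iη/2)·tr Σ_p Φ_p(A)` vanishes identically on the torus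
(`FlatPlaqIncidence.sum_plaq_curl_eq_zero`), the quadratic Taylor term of the plaquette word has trace `½tr((ΣY)²) = −(η²/2)tr Φ_p(A)²`.
[cite: Balaban1985Variational, (26)-(27) p.282, (157) p.302] -/
theorem action_eq_quad_add_V (A : PBond P j → Matrix (Fin 2) (Fin 2) ℂ) :
    (fun A : PBond P j → Matrix (Fin 2) (Fin 2) ℂ => (∑ p : Plaq P j, (1 - (2 : ℂ)⁻¹ * Matrix.trace (exp ((Complex.I * (η : ℂ)) • A ⟨p.src, p.μ⟩) * exp ((Complex.I * (η : ℂ)) • A ⟨p.src.shift p.μ, p.ν⟩) * exp (-((Complex.I * (η : ℂ)) • A ⟨p.src.shift p.ν, p.μ⟩)) * exp (-((Complex.I * (η : ℂ)) • A ⟨p.src, p.ν⟩)))))) A = ((η : ℂ) ^ 2 / 4) * (fun A : PBond P j → Matrix (Fin 2) (Fin 2) ℂ => (∑ p : Plaq P j, Matrix.trace ((A ⟨p.src, p.μ⟩ + A ⟨p.src.shift p.μ, p.ν⟩ - A ⟨p.src.shift p.ν, p.μ⟩ - A ⟨p.src, p.ν⟩) ^ 2))) A + (fun A : PBond P j → Matrix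 (Fin 2) (Fin 2) ℂ => (∑ p : Plaq P j, (1 - (2 : ℂ)⁻¹ * Matrix.trace (exp ((Complex.I * (η : ℂ)) • A ⟨p.src, p.μ⟩) * exp ((Complex.I * (η : ℂ)) • A ⟨p.src.shift p.μ, p.ν⟩) * exp (-((Complex.I * (η : ℂ)) • A ⟨p.src.shift p.ν, p.μ⟩)) * exp (-((Complex.I * (η : ℂ)) • A ⟨p.src, p.ν⟩))) + (2 : ℂ)⁻¹ * Matrix.trace (((Complex.I * (η : ℂ)) • A ⟨p.src, p.μ⟩) + ((Complex.I * (η : ℂ)) • A ⟨p.src.shift p.μ, p.ν⟩) + (-((Complex.I * (η : ℂ)) • A ⟨p.src.shift p.ν, p.μ⟩)) + (-((Complex.I * (η : ℂ)) • A ⟨p.src, p.ν⟩))) + (4 : ℂ)⁻¹ * Matrix.trace ((((Complex.I * (η : ℂ)) • A ⟨p.src, p.μ⟩) + ((Complex.I * (η : ℂ)) • A ⟨p.src.shift p.μ, p.ν⟩) + (-((Complex.I * (η : ℂ)) • A ⟨p.src.shift p.ν, p.μ⟩)) + (-((Complex.I * (η : ℂ)) • A ⟨p.src, p.ν⟩)))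 ^ 2)))) A := by
  have hlin : ∑ p : Plaq P j, Matrix.trace (((Complex.I * (η : ℂ)) • A ⟨p.src, p.μ⟩) + ((Complex.I * (η : ℂ)) • A ⟨p.src.shift p.μ, p.ν⟩) + (-((Complex.I * (η : ℂ)) • A ⟨p.src.shift p.ν, p.μ⟩)) + (-((Complex.I * (η : ℂ)) • A ⟨p.src, p.ν⟩))) = 0 := by
    have h := sum_plaq_curl_eq_zero (P := P) (j := j) (fun b => Matrix.trace ((Complex.I * (η : ℂ)) • A b))
    simp only [Matrix.trace_add, Matrix.trace_neg] at h ⊢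
    simpa [sub_eq_add_neg] using h
  have hquad : ∀ p : Plaq P j, Matrix.trace ((((Complex.I * (η : ℂ)) • A ⟨p.src, p.μ⟩) + ((Complex.I * (η : ℂ)) • A ⟨p.src.shift p.μ, p.ν⟩) + (-((Complex.I * (η : ℂ)) • A ⟨p.src.shift p.ν, p.μ⟩)) + (-((Complex.I * (η : ℂ)) • A ⟨p.src, p.ν⟩))) ^ 2) = -((η : ℂ) ^ 2) * Matrix.trace ((A ⟨p.src, p.μ⟩ + A ⟨p.src.shift p.μ, p.ν⟩ - A ⟨p.src.shift p.ν, p.μ⟩ - A ⟨p.src, p.ν⟩) ^ 2) := fun p => by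
    rw [slots_sum_eq_smul_curl η A p, trace_smul_curl_sq]
  simp only
  calc ∑ p : Plaq P j, (1 - (2 : ℂ)⁻¹ * Matrix.trace (exp ((Complex.I * (η : ℂ)) • A ⟨p.src, p.μ⟩) * exp ((Complex.I * (η : ℂ)) • A ⟨p.src.shift p.μ, p.ν⟩) * exp (-((Complex.I * (η : ℂ)) • A ⟨p.src.shift p.ν, p.μ⟩)) * exp (-((Complex.I * (η : ℂ)) • A ⟨p.src, p.ν⟩))))
      = ∑ p : Plaq P j, ((1 - (2 : ℂ)⁻¹ * Matrix.trace (exp ((Complex.I * (η : ℂ)) • A ⟨p.src, p.μ⟩) * exp ((Complex.I * (η : ℂ)) • A ⟨p.src.shift p.μ, p.ν⟩) * exp (-((Complex.I * (η : ℂ)) • A ⟨p.src.shift p.ν, p.μ⟩)) * exp (-((Complex.I * (η : ℂ)) • A ⟨p.src, p.ν⟩))) + (2 : ℂ)⁻¹ * Matrix.trace (((Complex.I * (η : ℂ)) • A ⟨p.src, p.μ⟩) + ((Complex.I * (η : ℂ)) • A ⟨p.src.shift p.μ, p.ν⟩) + (-((Complex.I * (η : ℂ)) • A ⟨p.src.shift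 p.ν, p.μ⟩)) + (-((Complex.I * (η : ℂ)) • A ⟨p.src, p.ν⟩))) + (4 : ℂ)⁻¹ * Matrix.trace ((((Complex.I * (η : ℂ)) • A ⟨p.src, p.μ⟩) + ((Complex.I * (η : ℂ)) • A ⟨p.src.shift p.μ, p.ν⟩) + (-((Complex.I * (η : ℂ)) • A ⟨p.src.shift p.ν, p.μ⟩)) + (-((Complex.I * (η : ℂ)) • A ⟨p.src, p.ν⟩))) ^ 2)) - (2 : ℂ)⁻¹ * Matrix.trace (((Complex.I * (η : ℂ)) • A ⟨p.src, p.μ⟩) + ((Complex.I * (η : ℂ)) • A ⟨p.src.shift p.μ, p.ν⟩) + (-((Complex.I * (η : ℂ)) • A ⟨p.src.shift p.ν, p.μ⟩)) + (-((Complex.I * (η : ℂ)) • A ⟨p.src, p.ν⟩))) - (4 : ℂ)⁻¹ * Matrix.trace ((((Complex.I * (η : ℂ)) • A ⟨p.src, p.μ⟩) + ((Complex.I * (η : ℂ)) • A ⟨p.src.shift p.μ, p.ν⟩) + (-((Complex.I * (η : ℂ)) • A ⟨p.src.shift p.ν, p.μ⟩)) + (-((Complex.I * (η : ℂ)) • A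 ⟨p.src, p.ν⟩))) ^ 2)) :=
        sum_congr rfl fun p _ => plaq_term_eq η A p
    _ = ∑ p : Plaq P j, (1 - (2 : ℂ)⁻¹ * Matrix.trace (exp ((Complex.I * (η : ℂ)) • A ⟨p.src, p.μ⟩) * exp ((Complex.I * (η : ℂ)) • A ⟨p.src.shift p.μ, p.ν⟩) * exp (-((Complex.I * (η : ℂ)) • A ⟨p.src.shift p.ν, p.μ⟩)) * exp (-((Complex.I * (η : ℂ)) • A ⟨p.src, p.ν⟩))) + (2 : ℂ)⁻¹ * Matrix.trace (((Complex.I * (η : ℂ)) • A ⟨p.src, p.μ⟩) + ((Complex.I * (η : ℂ)) • A ⟨p.src.shift p.μ, p.ν⟩) + (-((Complex.I * (η : ℂ)) • A ⟨p.src.shift p.ν, p.μ⟩)) + (-((Complex.I * (η : ℂ)) • A ⟨p.src, p.ν⟩))) + (4 : ℂ)⁻¹ * Matrix.trace ((((Complex.I * (η : ℂ)) • A ⟨p.src, p.μ⟩) + ((Complex.I * (η : ℂ)) • A ⟨p.src.shift p.μ, p.ν⟩) + (-((Complex.I * (η : ℂ)) • A ⟨p.src.shift p.ν, p.μ⟩))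 + (-((Complex.I * (η : ℂ)) • A ⟨p.src, p.ν⟩))) ^ 2)) - (2 : ℂ)⁻¹ * ∑ p : Plaq P j, Matrix.trace (((Complex.I * (η : ℂ)) • A ⟨p.src, p.μ⟩) + ((Complex.I * (η : ℂ)) • A ⟨p.src.shift p.μ, p.ν⟩) + (-((Complex.I * (η : ℂ)) • A ⟨p.src.shift p.ν, p.μ⟩)) + (-((Complex.I * (η : ℂ)) • A ⟨p.src, p.ν⟩))) - (4 : ℂ)⁻¹ * ∑ p : Plaq P j, Matrix.trace ((((Complex.I * (η : ℂ)) • A ⟨p.src, p.μ⟩) + ((Complex.I * (η : ℂ)) • A ⟨p.src.shift p.μ, p.ν⟩) + (-((Complex.I * (η : ℂ)) • A ⟨p.src.shift p.ν, p.μ⟩)) + (-((Complex.I * (η : ℂ)) • A ⟨p.src, p.ν⟩))) ^ 2) := by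
        rw [sum_sub_distrib, sum_sub_distrib, mul_sum, mul_sum]
    _ = ((η : ℂ) ^ 2 / 4) * ∑ p : Plaq P j, Matrix.trace ((A ⟨p.src, p.μ⟩ + A ⟨p.src.shift p.μ, p.ν⟩ - A ⟨p.src.shift p.ν, p.μ⟩ - A ⟨p.src, p.ν⟩) ^ 2) + ∑ p : Plaq P j, (1 - (2 : ℂ)⁻¹ * Matrix.trace (exp ((Complex.I * (η : ℂ)) • A ⟨p.src, p.μ⟩) * exp ((Complex.I * (η : ℂ)) • A ⟨p.src.shift p.μ, p.ν⟩) * exp (-((Complex.I * (η : ℂ)) • A ⟨p.src.shift p.ν, p.μ⟩)) * exp (-((Complex.I * (η : ℂ)) • A ⟨p.src, p.ν⟩))) + (2 : ℂ)⁻¹ * Matrix.trace (((Complex.I * (η : ℂ)) • A ⟨p.src, p.μ⟩) + ((Complex.I * (η : ℂ)) • A ⟨p.src.shift p.μ, p.ν⟩) + (-((Complex.I * (η : ℂ)) • A ⟨p.src.shift p.ν, p.μ⟩)) + (-((Complex.I * (η : ℂ)) • A ⟨p.src, p.ν⟩))) + (4 : ℂ)⁻¹ * Matrix.trace ((((Complex.I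 * (η : ℂ)) • A ⟨p.src, p.μ⟩) + ((Complex.I * (η : ℂ)) • A ⟨p.src.shift p.μ, p.ν⟩) + (-((Complex.I * (η : ℂ)) • A ⟨p.src.shift p.ν, p.μ⟩)) + (-((Complex.I * (η : ℂ)) • A ⟨p.src, p.ν⟩))) ^ 2)) := by
        rw [hlin, mul_zero, sub_zero, sum_congr rfl fun p _ => hquad p, ← mul_sum]
        ring

end Split

/-! ## §3 The quadratic form `𝒬(A) = Σ_p tr(Φ_p(A)²)` and its derivative -/

section Quad

/-- `d/dt tr((X + tY)²)|_{t₀} = tr(Y(X + t₀Y) + (X + t₀Y)Y)`. [folklore] -/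
theorem hasDerivAt_trace_sq_line (X Y : Matrix (Fin 2) (Fin 2) ℂ) (t₀ : ℂ) :
    HasDerivAt (fun t : ℂ => Matrix.trace ((X + t • Y) ^ 2)) (Matrix.trace (Y * (X + t₀ • Y) + (X + t₀ • Y) * Y)) t₀ := by
  have hline : HasDerivAt (fun t : ℂ => X + t • Y) Y t₀ := by
    simpa using ((hasDerivAt_id t₀).smul_const Y).const_add X
  have hsq : HasDerivAt (fun t : ℂ => (X + t • Y) * (X + t • Y)) (Y * (X + t₀ • Y) + (X + t₀ • Y) * Y) t₀ := hline.mul hline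
  have htr : HasDerivAt (fun t : ℂ => Matrix.trace ((X + t • Y) * (X + t • Y))) (Matrix.trace (Y * (X + t₀ • Y) + (X + t₀ • Y) * Y)) t₀ := by
    have h := (LinearMap.toContinuousLinearMap (Matrix.traceLinearMap (Fin 2) ℂ ℂ)).hasFDerivAt.comp_hasDerivAt t₀ hsq
    simpa [Function.comp_def] using h
  simpa only [sq] using htr

/-- `Φ_p` is linear along lines: `Φ_p(A + tδ) = Φ_p(A) + t·Φ_p(δ)`. [folklore] -/
theorem curl_line (A δ : PBond P j → Matrix (Fin 2) (Fin 2) ℂ) (t : ℂ) (p : Plaq P j) :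
    ((A + t • δ) ⟨p.src, p.μ⟩ + (A + t • δ) ⟨p.src.shift p.μ, p.ν⟩ - (A + t • δ) ⟨p.src.shift p.ν, p.μ⟩ - (A + t • δ) ⟨p.src, p.ν⟩) = (A ⟨p.src, p.μ⟩ + A ⟨p.src.shift p.μ, p.ν⟩ - A ⟨p.src.shift p.ν, p.μ⟩ - A ⟨p.src, p.ν⟩) + t • (δ ⟨p.src, p.μ⟩ + δ ⟨p.src.shift p.μ, p.ν⟩ - δ ⟨p.src.shift p.ν, p.μ⟩ - δ ⟨p.src, p.ν⟩) := by
  simp only [Pi.add_apply, Pi.smul_apply, smul_add, smul_sub]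
  abel

/-- **`𝒬` IS DIFFERENTIABLE** (a polynomial in the components). [folklore] -/
theorem differentiable_quad : Differentiable ℂ (fun A : PBond P j → Matrix (Fin 2) (Fin 2) ℂ => (∑ p : Plaq P j, Matrix.trace ((A ⟨p.src, p.μ⟩ + A ⟨p.src.shift p.μ, p.ν⟩ - A ⟨p.src.shift p.ν, p.μ⟩ - A ⟨p.src, p.ν⟩) ^ 2))) := by
  have hT : Differentiable ℂ (fun X : Matrix (Fin 2) (Fin 2) ℂ => Matrix.trace X) :=
    (LinearMap.toContinuousLinearMap (Matrix.traceLinearMap (Fin 2) ℂ ℂ)).differentiable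
  have hev : ∀ b : PBond P j, Differentiable ℂ (fun A : PBond P j → Matrix (Fin 2) (Fin 2) ℂ => A b) := fun b => differentiable_apply b
  refine Differentiable.fun_sum fun p _ => ?_
  have hΦ : Differentiable ℂ (fun A : PBond P j → Matrix (Fin 2) (Fin 2) ℂ => (A ⟨p.src, p.μ⟩ + A ⟨p.src.shift p.μ, p.ν⟩ - A ⟨p.src.shift p.ν, p.μ⟩ - A ⟨p.src, p.ν⟩)) :=
    (((hev _).add (hev _)).sub (hev _)).sub (hev _)
  exact hT.comp (hΦ.pow 2)

/-- **`D𝒬(A)[δ] = 2·Σ_p tr(Φ_p(A)Φ_p(δ))`** (line derivative + cyclicity of the trace). [cite: Balaban1985Variational, (27) p.282, (99) p.293] -/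
theorem fderiv_quad (A δ : PBond P j → Matrix (Fin 2) (Fin 2) ℂ) :
    fderiv ℂ (fun A : PBond P j → Matrix (Fin 2) (Fin 2) ℂ => (∑ p : Plaq P j, Matrix.trace ((A ⟨p.src, p.μ⟩ + A ⟨p.src.shift p.μ, p.ν⟩ - A ⟨p.src.shift p.ν, p.μ⟩ - A ⟨p.src, p.ν⟩) ^ 2))) A δ = 2 * ∑ p : Plaq P j, Matrix.trace ((A ⟨p.src, p.μ⟩ + A ⟨p.src.shift p.μ, p.ν⟩ - A ⟨p.src.shift p.ν, p.μ⟩ - A ⟨p.src, p.ν⟩) * (δ ⟨p.src, p.μ⟩ + δ ⟨p.src.shift p.μ, p.ν⟩ - δ ⟨p.src.shift p.ν, p.μ⟩ - δ ⟨p.src, p.ν⟩)) := by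
  have hline : HasDerivAt (fun t : ℂ => A + t • δ) δ 0 := by
    simpa using ((hasDerivAt_id (0 : ℂ)).smul_const δ).const_add A
  have h1 : HasDerivAt (fun t : ℂ => (fun A : PBond P j → Matrix (Fin 2) (Fin 2) ℂ => (∑ p : Plaq P j, Matrix.trace ((A ⟨p.src, p.μ⟩ + A ⟨p.src.shift p.μ, p.ν⟩ - A ⟨p.src.shift p.ν, p.μ⟩ - A ⟨p.src, p.ν⟩) ^ 2))) (A + t • δ)) (fderiv ℂ (fun A : PBond P j → Matrix (Fin 2) (Fin 2) ℂ => (∑ p : Plaq P j, Matrix.trace ((A ⟨p.src, p.μ⟩ + A ⟨p.src.shift p.μ, p.ν⟩ - A ⟨p.src.shift p.ν, p.μ⟩ - A ⟨p.src, p.ν⟩) ^ 2))) A δ) 0 := by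
    have h := (differentiable_quad (P := P) (j := j) (A + (0 : ℂ) • δ)).hasFDerivAt.comp_hasDerivAt (0 : ℂ) hline
    simpa only [Function.comp_def, zero_smul, add_zero] using h
  have h2 : HasDerivAt (fun t : ℂ => (fun A : PBond P j → Matrix (Fin 2) (Fin 2) ℂ => (∑ p : Plaq P j, Matrix.trace ((A ⟨p.src, p.μ⟩ + A ⟨p.src.shift p.μ, p.ν⟩ - A ⟨p.src.shift p.ν, p.μ⟩ - A ⟨p.src, p.ν⟩) ^ 2))) (A + t • δ)) (2 * ∑ p : Plaq P j, Matrix.trace ((A ⟨p.src, p.μ⟩ + A ⟨p.src.shift p.μ, p.ν⟩ - A ⟨p.src.shift p.ν, p.μ⟩ - A ⟨p.src, p.ν⟩) * (δ ⟨p.src, p.μ⟩ + δ ⟨p.src.shift p.μ, p.ν⟩ - δ ⟨p.src.shift p.ν, p.μ⟩ - δ ⟨p.src, p.ν⟩))) 0 := by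
    have e : (fun t : ℂ => (fun A : PBond P j → Matrix (Fin 2) (Fin 2) ℂ => (∑ p : Plaq P j, Matrix.trace ((A ⟨p.src, p.μ⟩ + A ⟨p.src.shift p.μ, p.ν⟩ - A ⟨p.src.shift p.ν, p.μ⟩ - A ⟨p.src, p.ν⟩) ^ 2))) (A + t • δ)) = fun t : ℂ => ∑ p : Plaq P j, Matrix.trace (((A ⟨p.src, p.μ⟩ + A ⟨p.src.shift p.μ, p.ν⟩ - A ⟨p.src.shift p.ν, p.μ⟩ - A ⟨p.src, p.ν⟩) + t • (δ ⟨p.src, p.μ⟩ + δ ⟨p.src.shift p.μ, p.ν⟩ - δ ⟨p.src.shift p.ν, p.μ⟩ - δ ⟨p.src, p.ν⟩)) ^ 2) := by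
      funext t
      exact sum_congr rfl fun p _ => by rw [curl_line A δ t p]
    rw [e, mul_sum]
    refine HasDerivAt.fun_sum fun p _ => ?_
    have h := hasDerivAt_trace_sq_line (A ⟨p.src, p.μ⟩ + A ⟨p.src.shift p.μ, p.ν⟩ - A ⟨p.src.shift p.ν, p.μ⟩ - A ⟨p.src, p.ν⟩) (δ ⟨p.src, p.μ⟩ + δ ⟨p.src.shift p.μ, p.ν⟩ - δ ⟨p.src.shift p.ν, p.μ⟩ - δ ⟨p.src, p.ν⟩) 0
    simp only [zero_smul, add_zero] at h
    have htr : Matrix.trace ((δ ⟨p.src, p.μ⟩ + δ ⟨p.src.shift p.μ, p.ν⟩ - δ ⟨p.src.shift p.ν, p.μ⟩ - δ ⟨p.src, p.ν⟩) * (A ⟨p.src, p.μ⟩ + A ⟨p.src.shift p.μ, p.ν⟩ - A ⟨p.src.shift p.ν, p.μ⟩ - A ⟨p.src, p.ν⟩) + (A ⟨p.src, p.μ⟩ + A ⟨p.src.shift p.μ, p.ν⟩ - A ⟨p.src.shift p.ν, p.μ⟩ - A ⟨p.src, p.ν⟩) * (δ ⟨p.src, p.μ⟩ + δ ⟨p.src.shift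 p.μ, p.ν⟩ - δ ⟨p.src.shift p.ν, p.μ⟩ - δ ⟨p.src, p.ν⟩)) = 2 * Matrix.trace ((A ⟨p.src, p.μ⟩ + A ⟨p.src.shift p.μ, p.ν⟩ - A ⟨p.src.shift p.ν, p.μ⟩ - A ⟨p.src, p.ν⟩) * (δ ⟨p.src, p.μ⟩ + δ ⟨p.src.shift p.μ, p.ν⟩ - δ ⟨p.src.shift p.ν, p.μ⟩ - δ ⟨p.src, p.ν⟩)) := by
      rw [Matrix.trace_add, Matrix.trace_mul_comm, two_mul]
    rwa [htr] at h
  exact h1.unique h2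

end Quad

/-! ## §4 The gradient of the action: `D𝒮_η(A)[δ] = (η²/2)Σ_p tr(Φ_p(A)Φ_p(δ)) + η⁴Σ_b tr(W₀(A)(b)δ(b))` -/

section Gradient

variable (η : ℝ)

/-- **THE GRADIENT OF THE WILSON ACTION IN THE FLAT EXPONENTIAL CHART.**  For every `Params`, level `j` and `0 < η ≤ 1` there is `W₀` with the four properties of P3b's
`exists_gradient_prop4_bg1` VERBATIM ((i) `𝒱_η` differentiable with `D𝒱_η(A)[δ] = η⁴Σ_b tr(W₀(A)(b)δ(b))`; (ii) `W₀` differentiable; (iii) (98) with `a₃ = ½`, `C₄ = 6000d`)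
AND: `𝒮_η` is differentiable and `D𝒮_η(A)[δ] = (η²/2)·Σ_p tr(Φ_p(A)Φ_p(δ)) + η⁴·Σ_b tr(W₀(A)(b)δ(b))` for all `A, δ` — print's (99) at background 1, `J = 0`: the first variation
is the flat `∂^{η*}∂^η`-pairing plus the gradient of `V₀`. [cite: Balaban1985Variational, (99) p.293, (26)-(27) p.282, Prop. 4 (97)-(98) pp.292-293] -/
theorem exists_gradient_action (hη : 0 < η) (hη1 : η ≤ 1) :
    ∃ W : (PBond P j → Matrix (Fin 2) (Fin 2) ℂ) → (PBond P j → Matrix (Fin 2) (Fin 2) ℂ),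
      Differentiable ℂ (fun A : PBond P j → Matrix (Fin 2) (Fin 2) ℂ => (∑ p : Plaq P j, (1 - (2 : ℂ)⁻¹ * Matrix.trace (exp ((Complex.I * (η : ℂ)) • A ⟨p.src, p.μ⟩) * exp ((Complex.I * (η : ℂ)) • A ⟨p.src.shift p.μ, p.ν⟩) * exp (-((Complex.I * (η : ℂ)) • A ⟨p.src.shift p.ν, p.μ⟩)) * exp (-((Complex.I * (η : ℂ)) • A ⟨p.src, p.ν⟩))) + (2 : ℂ)⁻¹ * Matrix.trace (((Complex.I * (η : ℂ)) • A ⟨p.src, p.μ⟩) + ((Complex.I * (η : ℂ)) • A ⟨p.src.shift p.μ, p.ν⟩) + (-((Complex.I * (η : ℂ)) • A ⟨p.src.shift p.ν, p.μ⟩)) + (-((Complex.I * (η : ℂ)) • A ⟨p.src, p.ν⟩))) + (4 : ℂ)⁻¹ * Matrix.trace ((((Complex.I * (η : ℂ)) • A ⟨p.src, p.μ⟩) + ((Complex.I * (η : ℂ)) • A ⟨p.src.shift p.μ, p.ν⟩) + (-((Complex.I * (η : ℂ)) • A ⟨p.src.shift p.ν, p.μ⟩)) + (-((Complex.I * (η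 : ℂ)) • A ⟨p.src, p.ν⟩))) ^ 2)))) ∧
      (∀ A δ : PBond P j → Matrix (Fin 2) (Fin 2) ℂ, fderiv ℂ (fun A : PBond P j → Matrix (Fin 2) (Fin 2) ℂ => (∑ p : Plaq P j, (1 - (2 : ℂ)⁻¹ * Matrix.trace (exp ((Complex.I * (η : ℂ)) • A ⟨p.src, p.μ⟩) * exp ((Complex.I * (η : ℂ)) • A ⟨p.src.shift p.μ, p.ν⟩) * exp (-((Complex.I * (η : ℂ)) • A ⟨p.src.shift p.ν, p.μ⟩)) * exp (-((Complex.I * (η : ℂ)) • A ⟨p.src, p.ν⟩))) + (2 : ℂ)⁻¹ * Matrix.trace (((Complex.I * (η : ℂ)) • A ⟨p.src, p.μ⟩) + ((Complex.I * (η : ℂ)) • A ⟨p.src.shift p.μ, p.ν⟩) + (-((Complex.I * (η : ℂ)) • A ⟨p.src.shift p.ν, p.μ⟩)) + (-((Complex.I * (η : ℂ)) • A ⟨p.src, p.ν⟩))) + (4 : ℂ)⁻¹ * Matrix.trace ((((Complex.I * (η : ℂ)) • A ⟨p.src, p.μ⟩) + ((Complex.I * (η : ℂ)) • A ⟨p.src.shift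 p.μ, p.ν⟩) + (-((Complex.I * (η : ℂ)) • A ⟨p.src.shift p.ν, p.μ⟩)) + (-((Complex.I * (η : ℂ)) • A ⟨p.src, p.ν⟩))) ^ 2)))) A δ = (η : ℂ) ^ 4 * ∑ b : PBond P j, Matrix.trace (W A b * δ b)) ∧
      Differentiable ℂ W ∧
      (∀ (Y : PBond P j → Matrix (Fin 2) (Fin 2) ℂ) (r : ℝ), r < 1 / 2 → (∀ b, ‖Y b‖ ≤ r) →
        (∀ (s : Site P j) (μ ν : Fin P.d), η⁻¹ * ‖Y ⟨s.shift ν, μ⟩ - Y ⟨s, μ⟩‖ ≤ r) → ∀ b, ‖W Y b‖ ≤ 6000 * P.d * r ^ 2) ∧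
      Differentiable ℂ (fun A : PBond P j → Matrix (Fin 2) (Fin 2) ℂ => (∑ p : Plaq P j, (1 - (2 : ℂ)⁻¹ * Matrix.trace (exp ((Complex.I * (η : ℂ)) • A ⟨p.src, p.μ⟩) * exp ((Complex.I * (η : ℂ)) • A ⟨p.src.shift p.μ, p.ν⟩) * exp (-((Complex.I * (η : ℂ)) • A ⟨p.src.shift p.ν, p.μ⟩)) * exp (-((Complex.I * (η : ℂ)) • A ⟨p.src, p.ν⟩)))))) ∧
      (∀ A δ : PBond P j → Matrix (Fin 2) (Fin 2) ℂ, fderiv ℂ (fun A : PBond P j → Matrix (Fin 2) (Fin 2) ℂ => (∑ p : Plaq P j, (1 - (2 : ℂ)⁻¹ * Matrix.trace (exp ((Complex.I * (η : ℂ)) • A ⟨p.src, p.μ⟩) * exp ((Complex.I * (η : ℂ)) • A ⟨p.src.shift p.μ, p.ν⟩) * exp (-((Complex.I * (η : ℂ)) • A ⟨p.src.shift p.ν, p.μ⟩)) * exp (-((Complex.I * (η : ℂ)) • A ⟨p.src, p.ν⟩)))))) A δ =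
        ((η : ℂ) ^ 2 / 2) * ∑ p : Plaq P j, Matrix.trace ((A ⟨p.src, p.μ⟩ + A ⟨p.src.shift p.μ, p.ν⟩ - A ⟨p.src.shift p.ν, p.μ⟩ - A ⟨p.src, p.ν⟩) * (δ ⟨p.src, p.μ⟩ + δ ⟨p.src.shift p.μ, p.ν⟩ - δ ⟨p.src.shift p.ν, p.μ⟩ - δ ⟨p.src, p.ν⟩)) + (η : ℂ) ^ 4 * ∑ b : PBond P j, Matrix.trace (W A b * δ b)) := by
  obtain ⟨W, hVd, hgrad, hWd, hWq⟩ := exists_gradient_prop4_bg1 (P := P) (j := j) η hη hη1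
  have hQd := differentiable_quad (P := P) (j := j)
  have hS : (fun A : PBond P j → Matrix (Fin 2) (Fin 2) ℂ => (∑ p : Plaq P j, (1 - (2 : ℂ)⁻¹ * Matrix.trace (exp ((Complex.I * (η : ℂ)) • A ⟨p.src, p.μ⟩) * exp ((Complex.I * (η : ℂ)) • A ⟨p.src.shift p.μ, p.ν⟩) * exp (-((Complex.I * (η : ℂ)) • A ⟨p.src.shift p.ν, p.μ⟩)) * exp (-((Complex.I * (η : ℂ)) • A ⟨p.src, p.ν⟩)))))) = fun A => ((η : ℂ) ^ 2 / 4) * (fun A : PBond P j → Matrix (Fin 2) (Fin 2) ℂ => (∑ p : Plaq P j, Matrix.trace ((A ⟨p.src, p.μ⟩ + A ⟨p.src.shift p.μ, p.ν⟩ - A ⟨p.src.shift p.ν, p.μ⟩ - A ⟨p.src, p.ν⟩) ^ 2))) A + (fun A : PBond P j → Matrix (Fin 2) (Fin 2) ℂ => (∑ p : Plaq P j, (1 - (2 : ℂ)⁻¹ * Matrix.trace (exp ((Complex.I * (η : ℂ)) • A ⟨p.src, p.μ⟩) * exp ((Complex.I * (η : ℂ)) • A ⟨p.src.shift p.μ,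 p.ν⟩) * exp (-((Complex.I * (η : ℂ)) • A ⟨p.src.shift p.ν, p.μ⟩)) * exp (-((Complex.I * (η : ℂ)) • A ⟨p.src, p.ν⟩))) + (2 : ℂ)⁻¹ * Matrix.trace (((Complex.I * (η : ℂ)) • A ⟨p.src, p.μ⟩) + ((Complex.I * (η : ℂ)) • A ⟨p.src.shift p.μ, p.ν⟩) + (-((Complex.I * (η : ℂ)) • A ⟨p.src.shift p.ν, p.μ⟩)) + (-((Complex.I * (η : ℂ)) • A ⟨p.src, p.ν⟩))) + (4 : ℂ)⁻¹ * Matrix.trace ((((Complex.I * (η : ℂ)) • A ⟨p.src, p.μ⟩) + ((Complex.I * (η : ℂ)) • A ⟨p.src.shift p.μ, p.ν⟩) + (-((Complex.I * (η : ℂ)) • A ⟨p.src.shift p.ν, p.μ⟩)) + (-((Complex.I * (η : ℂ)) • A ⟨p.src, p.ν⟩))) ^ 2)))) A := funext fun A => action_eq_quad_add_V η A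
  have hSd : Differentiable ℂ (fun A : PBond P j → Matrix (Fin 2) (Fin 2) ℂ => (∑ p : Plaq P j, (1 - (2 : ℂ)⁻¹ * Matrix.trace (exp ((Complex.I * (η : ℂ)) • A ⟨p.src, p.μ⟩) * exp ((Complex.I * (η : ℂ)) • A ⟨p.src.shift p.μ, p.ν⟩) * exp (-((Complex.I * (η : ℂ)) • A ⟨p.src.shift p.ν, p.μ⟩)) * exp (-((Complex.I * (η : ℂ)) • A ⟨p.src, p.ν⟩)))))) := by
    rw [hS]; exact (hQd.const_mul _).add hVd
  refine ⟨W, hVd, hgrad, hWd, hWq, hSd, fun A δ => ?_⟩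
  have hder : HasFDerivAt (fun A => ((η : ℂ) ^ 2 / 4) * (fun A : PBond P j → Matrix (Fin 2) (Fin 2) ℂ => (∑ p : Plaq P j, Matrix.trace ((A ⟨p.src, p.μ⟩ + A ⟨p.src.shift p.μ, p.ν⟩ - A ⟨p.src.shift p.ν, p.μ⟩ - A ⟨p.src, p.ν⟩) ^ 2))) A + (fun A : PBond P j → Matrix (Fin 2) (Fin 2) ℂ => (∑ p : Plaq P j, (1 - (2 : ℂ)⁻¹ * Matrix.trace (exp ((Complex.I * (η : ℂ)) • A ⟨p.src, p.μ⟩) * exp ((Complex.I * (η : ℂ)) • A ⟨p.src.shift p.μ, p.ν⟩) * exp (-((Complex.I * (η : ℂ)) • A ⟨p.src.shift p.ν, p.μ⟩)) * exp (-((Complex.I * (η : ℂ)) • A ⟨p.src, p.ν⟩))) + (2 : ℂ)⁻¹ * Matrix.trace (((Complex.I * (η : ℂ)) • A ⟨p.src, p.μ⟩) + ((Complex.I * (η : ℂ)) • A ⟨p.src.shift p.μ, p.ν⟩) + (-((Complex.I * (η : ℂ)) • A ⟨p.src.shift p.ν, p.μ⟩)) + (-((Complex.I * (η : ℂ)) •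 A ⟨p.src, p.ν⟩))) + (4 : ℂ)⁻¹ * Matrix.trace ((((Complex.I * (η : ℂ)) • A ⟨p.src, p.μ⟩) + ((Complex.I * (η : ℂ)) • A ⟨p.src.shift p.μ, p.ν⟩) + (-((Complex.I * (η : ℂ)) • A ⟨p.src.shift p.ν, p.μ⟩)) + (-((Complex.I * (η : ℂ)) • A ⟨p.src, p.ν⟩))) ^ 2)))) A)
      (((η : ℂ) ^ 2 / 4) • fderiv ℂ (fun A : PBond P j → Matrix (Fin 2) (Fin 2) ℂ => (∑ p : Plaq P j, Matrix.trace ((A ⟨p.src, p.μ⟩ + A ⟨p.src.shift p.μ, p.ν⟩ - A ⟨p.src.shift p.ν, p.μ⟩ - A ⟨p.src, p.ν⟩) ^ 2))) A + fderiv ℂ (fun A : PBond P j → Matrix (Fin 2) (Fin 2) ℂ => (∑ p : Plaq P j, (1 - (2 : ℂ)⁻¹ * Matrix.trace (exp ((Complex.I * (η : ℂ)) • A ⟨p.src, p.μ⟩) * exp ((Complex.I * (η : ℂ)) • A ⟨p.src.shift p.μ, p.ν⟩) * exp (-((Complex.I * (η : ℂ)) • A ⟨p.src.shift p.ν, p.μ⟩))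 * exp (-((Complex.I * (η : ℂ)) • A ⟨p.src, p.ν⟩))) + (2 : ℂ)⁻¹ * Matrix.trace (((Complex.I * (η : ℂ)) • A ⟨p.src, p.μ⟩) + ((Complex.I * (η : ℂ)) • A ⟨p.src.shift p.μ, p.ν⟩) + (-((Complex.I * (η : ℂ)) • A ⟨p.src.shift p.ν, p.μ⟩)) + (-((Complex.I * (η : ℂ)) • A ⟨p.src, p.ν⟩))) + (4 : ℂ)⁻¹ * Matrix.trace ((((Complex.I * (η : ℂ)) • A ⟨p.src, p.μ⟩) + ((Complex.I * (η : ℂ)) • A ⟨p.src.shift p.μ, p.ν⟩) + (-((Complex.I * (η : ℂ)) • A ⟨p.src.shift p.ν, p.μ⟩)) + (-((Complex.I * (η : ℂ)) • A ⟨p.src, p.ν⟩))) ^ 2)))) A) A :=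
    ((hQd A).hasFDerivAt.const_mul ((η : ℂ) ^ 2 / 4)).add (hVd A).hasFDerivAt
  rw [hS, hder.fderiv, add_apply, smul_apply, fderiv_quad, hgrad A δ, smul_eq_mul]
  ring

end Gradient

/-! ## §5 The tree's Wilson action is the real part of `𝒮_η` in the chart -/

section Wilson

variable (η : ℝ)

/-- `↑(U⁻¹) = e^{−iηA}` for `↑U = e^{iηA}` with `A` self-adjoint (`(e^X)* = e^{X*}`, `(iηA)* = −iηA`). [folklore] -/
theorem coe_inv_eq_exp_neg {A : Matrix (Fin 2) (Fin 2) ℂ} (hA : IsSelfAdjoint A) (U : Matrix.specialUnitaryGroup (Fin 2) ℂ)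
    (hU : (U : Matrix (Fin 2) (Fin 2) ℂ) = exp ((Complex.I * (η : ℂ)) • A)) :
    ((U⁻¹ : Matrix.specialUnitaryGroup (Fin 2) ℂ) : Matrix (Fin 2) (Fin 2) ℂ) = exp (-((Complex.I * (η : ℂ)) • A)) := by
  rw [← Matrix.star_eq_inv, Matrix.specialUnitaryGroup.coe_star, hU, star_exp, star_smul, hA.star_eq, ← neg_smul]
  congr 1
  simp [Complex.conj_ofReal]

/-- **`wilsonAction4 U = Re 𝒮_η(A)` IN THE FLAT EXPONENTIAL CHART**: for a bondwise self-adjoint `A` and an `SU(2)` configuration `U` with `↑U(b) = e^{iηA(b)}` for every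
bond, the tree's `wilsonAction4 U = Σ_p [1 − ½Re tr U(∂p)]` (`Setup.wilsonAction`, `GaugeField.plaqHol`, `UnitaryModel` trace) is the real part of the holomorphic
plaquette action `𝒮_η(A)`. [cite: Balaban1985Variational, (5) p.278, (157) p.302] -/
theorem wilsonAction4_eq_re_action (A : PBond P j → Matrix (Fin 2) (Fin 2) ℂ) (hA : ∀ b, IsSelfAdjoint (A b))
    (U : GaugeField P j (Matrix.specialUnitaryGroup (Fin 2) ℂ)) (hU : ∀ b, ((U b : Matrix.specialUnitaryGroup (Fin 2) ℂ) : Matrix (Fin 2) (Fin 2) ℂ) = exp ((Complex.I * (η : ℂ)) • A b)) :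
    wilsonAction4 U = ((fun A : PBond P j → Matrix (Fin 2) (Fin 2) ℂ => (∑ p : Plaq P j, (1 - (2 : ℂ)⁻¹ * Matrix.trace (exp ((Complex.I * (η : ℂ)) • A ⟨p.src, p.μ⟩) * exp ((Complex.I * (η : ℂ)) • A ⟨p.src.shift p.μ, p.ν⟩) * exp (-((Complex.I * (η : ℂ)) • A ⟨p.src.shift p.ν, p.μ⟩)) * exp (-((Complex.I * (η : ℂ)) • A ⟨p.src, p.ν⟩)))))) A).re := by
  unfold wilsonAction4 wilsonAction
  simp only [one_mul, Complex.re_sum]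
  refine sum_congr rfl fun p _ => ?_
  -- `reTr = Re tr ∕ 2` on `SU(2)` (`UnitaryModel.nReTr` through the fundamental representation; tree: `reTr_eq_trace_re`)
  rw [show reTr (GaugeField.plaqHol U p) = (((GaugeField.plaqHol U p : Matrix.specialUnitaryGroup (Fin 2) ℂ) : Matrix (Fin 2) (Fin 2) ℂ).trace).re / 2 from by
    show UnitaryModel.nReTr (Literature.MathematicalPhysics.QuantumLattice.fundamentalRep (Fin 2) _) = _
    simp [UnitaryModel.nReTr, Literature.MathematicalPhysics.QuantumLattice.fundamentalRep_apply]]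
  have hhol : ((GaugeField.plaqHol U p : Matrix.specialUnitaryGroup (Fin 2) ℂ) : Matrix (Fin 2) (Fin 2) ℂ) = exp ((Complex.I * (η : ℂ)) • A ⟨p.src, p.μ⟩) * exp ((Complex.I * (η : ℂ)) • A ⟨p.src.shift p.μ, p.ν⟩) * exp (-((Complex.I * (η : ℂ)) • A ⟨p.src.shift p.ν, p.μ⟩)) * exp (-((Complex.I * (η : ℂ)) • A ⟨p.src, p.ν⟩)) := by
    unfold GaugeField.plaqHol
    rw [Submonoid.coe_mul, Submonoid.coe_mul, Submonoid.coe_mul, hU, hU, coe_inv_eq_exp_neg η (hA _) _ (hU _), coe_inv_eq_exp_neg η (hA _) _ (hU _)]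
  rw [hhol]
  simp only [Complex.sub_re, Complex.one_re, Complex.mul_re, Complex.inv_re, Complex.inv_im]
  norm_num
  ring

end Wilson

/-! ## §6 At the d = 3 carrier: `P = F.P K`, `η = L^{−(K−n)}` -/

section T3

open T3ContinuumYM3Torus (T3Family)

/-- **THE GRADIENT OF THE WILSON ACTION IN THE FLAT CHART AT THE d = 3 CARRIER** (fine torus `PBond (F.P K) 0`, `η = L^{−(K−n)}`): P3b's `W₀` with the letters of
`exists_gradient_prop4_bg1_T3` ((grad), entire, (98) with weight `L^{K−n}`, `a₃ = ½`, `C₄ = 18000`) AND the derivative of `𝒮_η`: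
`D𝒮_η(A)[δ] = (η²/2)Σ_p tr(Φ_p(A)Φ_p(δ)) + η⁴Σ_b tr(W₀(A)(b)δ(b))`; member-uniform. [cite: Balaban1985Variational, (99) p.293, (157)-(158) p.302] -/
theorem exists_gradient_action_T3 (F : T3Family) (n K : ℕ) :
    ∃ W : (PBond (F.P K) 0 → Matrix (Fin 2) (Fin 2) ℂ) → (PBond (F.P K) 0 → Matrix (Fin 2) (Fin 2) ℂ),
      (∀ A δ : PBond (F.P K) 0 → Matrix (Fin 2) (Fin 2) ℂ, fderiv ℂ (fun A : PBond (F.P K) 0 → Matrix (Fin 2) (Fin 2) ℂ => (∑ p : Plaq (F.P K) 0, (1 - (2 : ℂ)⁻¹ * Matrix.trace (exp ((Complex.I * (((((F.L : ℝ)⁻¹) ^ (K - n) : ℝ)) : ℂ)) • A ⟨p.src, p.μ⟩) * exp ((Complex.I * (((((F.L : ℝ)⁻¹) ^ (K - n) : ℝ)) : ℂ)) • A ⟨p.src.shift p.μ, p.ν⟩) * exp (-((Complex.I * (((((F.L : ℝ)⁻¹) ^ (K - n) : ℝ)) : ℂ)) • A ⟨p.src.shift p.ν, p.μ⟩)) *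 exp (-((Complex.I * (((((F.L : ℝ)⁻¹) ^ (K - n) : ℝ)) : ℂ)) • A ⟨p.src, p.ν⟩))) + (2 : ℂ)⁻¹ * Matrix.trace (((Complex.I * (((((F.L : ℝ)⁻¹) ^ (K - n) : ℝ)) : ℂ)) • A ⟨p.src, p.μ⟩) + ((Complex.I * (((((F.L : ℝ)⁻¹) ^ (K - n) : ℝ)) : ℂ)) • A ⟨p.src.shift p.μ, p.ν⟩) + (-((Complex.I * (((((F.L : ℝ)⁻¹) ^ (K - n) : ℝ)) : ℂ)) • A ⟨p.src.shift p.ν, p.μ⟩)) + (-((Complex.I * (((((F.L : ℝ)⁻¹) ^ (K - n) : ℝ)) : ℂ)) • A ⟨p.src, p.ν⟩))) + (4 : ℂ)⁻¹ * Matrix.trace ((((Complex.I * (((((F.L : ℝ)⁻¹) ^ (K - n) : ℝ)) : ℂ)) • A ⟨p.src, p.μ⟩) + ((Complex.I * (((((F.L : ℝ)⁻¹) ^ (K - n) : ℝ)) : ℂ)) • A ⟨p.src.shift p.μ, p.ν⟩) + (-((Complex.I * (((((F.L : ℝ)⁻¹) ^ (K - n) : ℝ)) : ℂ)) • A ⟨p.src.shift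 p.ν, p.μ⟩)) + (-((Complex.I * (((((F.L : ℝ)⁻¹) ^ (K - n) : ℝ)) : ℂ)) • A ⟨p.src, p.ν⟩))) ^ 2)))) A δ =
        ((((F.L : ℝ)⁻¹) ^ (K - n) : ℝ) : ℂ) ^ 4 * ∑ b : PBond (F.P K) 0, Matrix.trace (W A b * δ b)) ∧
      Differentiable ℂ W ∧
      (∀ (Y : PBond (F.P K) 0 → Matrix (Fin 2) (Fin 2) ℂ) (r : ℝ), r < 1 / 2 → (∀ b, ‖Y b‖ ≤ r) →
        (∀ (s : Site (F.P K) 0) (μ ν : Fin 3), (F.L : ℝ) ^ (K - n) * ‖Y ⟨s.shift ν, μ⟩ - Y ⟨s, μ⟩‖ ≤ r) → ∀ b, ‖W Y b‖ ≤ 18000 * r ^ 2) ∧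
      Differentiable ℂ (fun A : PBond (F.P K) 0 → Matrix (Fin 2) (Fin 2) ℂ => (∑ p : Plaq (F.P K) 0, (1 - (2 : ℂ)⁻¹ * Matrix.trace (exp ((Complex.I * (((((F.L : ℝ)⁻¹) ^ (K - n) : ℝ)) : ℂ)) • A ⟨p.src, p.μ⟩) * exp ((Complex.I * (((((F.L : ℝ)⁻¹) ^ (K - n) : ℝ)) : ℂ)) • A ⟨p.src.shift p.μ, p.ν⟩) * exp (-((Complex.I * (((((F.L : ℝ)⁻¹) ^ (K - n) : ℝ)) : ℂ)) • A ⟨p.src.shift p.ν, p.μ⟩)) * exp (-((Complex.I * (((((F.L : ℝ)⁻¹) ^ (K - n) : ℝ)) : ℂ)) • A ⟨p.src, p.ν⟩)))))) ∧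
      (∀ A δ : PBond (F.P K) 0 → Matrix (Fin 2) (Fin 2) ℂ, fderiv ℂ (fun A : PBond (F.P K) 0 → Matrix (Fin 2) (Fin 2) ℂ => (∑ p : Plaq (F.P K) 0, (1 - (2 : ℂ)⁻¹ * Matrix.trace (exp ((Complex.I * (((((F.L : ℝ)⁻¹) ^ (K - n) : ℝ)) : ℂ)) • A ⟨p.src, p.μ⟩) * exp ((Complex.I * (((((F.L : ℝ)⁻¹) ^ (K - n) : ℝ)) : ℂ)) • A ⟨p.src.shift p.μ, p.ν⟩) * exp (-((Complex.I * (((((F.L : ℝ)⁻¹) ^ (K - n) : ℝ)) : ℂ)) • A ⟨p.src.shift p.ν, p.μ⟩)) * exp (-((Complex.I * (((((F.L : ℝ)⁻¹) ^ (K - n) : ℝ)) : ℂ)) • A ⟨p.src, p.ν⟩)))))) A δ =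
        (((((F.L : ℝ)⁻¹) ^ (K - n) : ℝ) : ℂ) ^ 2 / 2) * ∑ p : Plaq (F.P K) 0, Matrix.trace ((A ⟨p.src, p.μ⟩ + A ⟨p.src.shift p.μ, p.ν⟩ - A ⟨p.src.shift p.ν, p.μ⟩ - A ⟨p.src, p.ν⟩) * (δ ⟨p.src, p.μ⟩ + δ ⟨p.src.shift p.μ, p.ν⟩ - δ ⟨p.src.shift p.ν, p.μ⟩ - δ ⟨p.src, p.ν⟩)) +
          ((((F.L : ℝ)⁻¹) ^ (K - n) : ℝ) : ℂ) ^ 4 * ∑ b : PBond (F.P K) 0, Matrix.trace (W A b * δ b)) := by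
  have hL : (1 : ℝ) < F.L := by exact_mod_cast F.hL.2
  have hη : 0 < (((F.L : ℝ)⁻¹) ^ (K - n)) := pow_pos (inv_pos.mpr (by linarith)) _
  have hη1 : (((F.L : ℝ)⁻¹) ^ (K - n)) ≤ 1 := pow_le_one₀ (inv_nonneg.mpr (by linarith)) (inv_le_one_of_one_le₀ hL.le)
  obtain ⟨W, -, h2, h3, h4, h5, h6⟩ := exists_gradient_action (P := F.P K) (j := 0) (((F.L : ℝ)⁻¹) ^ (K - n)) hη hη1
  refine ⟨W, h2, h3, fun Y r hr hA hD b => ?_, h5, h6⟩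
  have hinv : ((((F.L : ℝ)⁻¹) ^ (K - n)))⁻¹ = (F.L : ℝ) ^ (K - n) := by rw [inv_pow, inv_inv]
  have hD' : ∀ (s : Site (F.P K) 0) (μ ν : Fin (F.P K).d), ((((F.L : ℝ)⁻¹) ^ (K - n)))⁻¹ * ‖Y ⟨s.shift ν, μ⟩ - Y ⟨s, μ⟩‖ ≤ r := by
    intro s μ ν; rw [hinv]; exact hD s μ ν
  have h := h4 Y r hr hA hD' b
  have hd : ((F.P K).d : ℝ) = 3 := by simp
  rw [hd] at h
  linarith

end T3

end Summit.QuantumFields.YangMills.Theorems.FlatActionGradient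

end
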